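import Mathlib.FieldTheory.IsAlgClosed.Classification
import Mathlib.RingTheory.Algebraic.Cardinality
import Mathlib.RingTheory.Localization.Cardinality
import Mathlib.Topology.Algebra.Module.Cardinality
import Literature.FieldTheory.AlgClosed.PadicAlgClEquivComplex
import Summits.ABC.IUTFork.Joshi.ArithHolStructureTiltAlgClosed
import Summits.ABC.IUTFork.Joshi.UntiltGaussNonIso
import HarnessLib

/-!
# The Gauss untilt AGAINST THE TILT (1/2): `𝔾` is not an untilt of `ℂ_p^♭` — no common tilt base with `ℂ_p`, no isometry
# `𝔾^♭ → ℂ_p^♭`; tilts of untilts of cardinality `≤ 𝔠` are all abstractly isomorphic (the input of the calibration in part 2/2)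

Proof-and-construction companion (abc-iut cell, block E, rung LADDER-ABC:A2.E; seat abc-iut-E-t55 g4, [J-I] §3/§7 untilt
lineage: `Joshi/UntiltGauss.lean` p447273 — the Gauss untilt `Untilt.gauss p r hr` / `𝔾 := Untilt.gaussIrr p` of radius `p^√2`,
`‖p‖ = p⁻¹`, an element `gaussT` of norm `r`, the isometric `algClGauss : Q̄_p ↪ 𝔾`; `Joshi/UntiltGaussNonIso.lean` p448902 — the
value set of `ℂ_p`, `¬ ℂ_p.TopIso 𝔾`, the two-point signature `twoPoint`) over
abc-iut-E-t10's TILT TOOLKIT, consumed BY NAME (`ATS1.tilt` p431050/p437040; `TiltMonoidDatum`, `range_norm_eq`, `sharpHom`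
p433682/p437482; `TiltModel.normedFieldTilt`, `tiltMonoidDatum`, `range_norm_tilt_eq` p442777; `completeSpace_tilt` p447287;
`isUltrametricDist_tilt` p446090; `isAlgClosed_tilt`, `ArithHolStructure.ofTilt` p453124) and E-t1's carriers (`Untilt`, `TopIso`,
`ATSObj.embPadicComplex`, `UntiltPoints`, p428170/p429850). Mathlib + `Literature.FieldTheory.AlgClosed.PadicAlgClEquivComplex`
(`Cardinal.mk_padic`, `Cardinal.mk_padicAlgCl`). Nothing of E-t1's / E-t10's is restated or edited; no `Prop` claim, no fact, no
instance on a foreign carrier, no sorry. TAKES NO SIDE on [IUTchIII] Cor. 3.12 or on any author; typed ≠ proved ≠ endorsed.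

SOURCE (K. Joshi, arXiv 2106.11452 **v4**, UNREFEREED; typed AS A CANDIDATE, D-0012; cell render): §3.5 p.9 l.38–40 «by an untilt
of F, I will mean a perfectoid field K, of characteristic zero, with K♭ isometric with F» / «with an isometry K♭ ≃ F»; §3.6 p.10
l.10–13 «Without further mention, all untilts K will be assumed to be of this type»; §3.7 p.10 l.14–17 «there exist untilts of ℂ_p^♭
which are not topologically isomorphic … [Kedlaya and Temkin, 2018, Theorem 1.3]»; Rmk. 3.16.3 p.16 l.8–12 (same-tilt statement);
Def. 4.1.1 p.18 l.11–22 «(1) a choice of an untilt (K ⊃ E, K♭ ≃ F) for some algebraically closed, perfectoid field F of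
characteristic p > 0»; Prop. 4.1.7 p.19 l.22–43 «(1) … K₁, K₂ have characteristic zero and have the same cardinality, the same
residue fields and the same value groups as that of F. (2) There exist arithmetic holomorphic structures … which are not isomorphic.
Furthermore, if F = ℂ_p^♭, then K₁, K₂ need not even be topologically isomorphic».

WHAT THE PARENT FILES LEFT OPEN. The four g3 files settle the TYPED sentences a second untilt can settle WITHOUT a tilt (`TopIso`
fails, Thm. 7.4.3 (1), Rmk. 3.16.2, `ExistsNonIsomorphic` / `ActionChangesTopology` non-vacuous) and say IN PROSE that `𝔾` is not an
untilt of `ℂ_p^♭`. With E-t10's toolkit (`K♭` as a normed field, the tilt-monoid datum) that caveat is now a KERNEL STATEMENT, and the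
typed Def. 4.1.1 can be tested against it. WHAT IS PROVED:

§0 CARDINALS [folklore]: `#(Completion α) ≤ #α^ℵ₀`; `#ℂ_p = 𝔠`; `#𝔾 = 𝔠`; for every untilt `𝔠 ≤ #K♭ ≤ #K^ℵ₀`, so `#K♭ = 𝔠` when
`#K ≤ 𝔠`; hence (Steinitz, Mathlib `IsAlgClosed.ringEquiv_of_equiv_of_char_eq`, with E-t10's `isAlgClosed_tilt` / `charP_tilt`)
**any two untilts of cardinality `≤ 𝔠` have ABSTRACTLY ISOMORPHIC tilts** (`nonempty_ringEquiv_tilt`).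
§1 `𝔾` IS NOT AN UNTILT OF `ℂ_p^♭` (kernel form of the g3 caveat): two untilts carrying tilt-monoid data over ONE base `F` have the
same value set (`range_norm_eq_of_tiltMonoidDatum`, from E-t10's `range_norm_eq`); `p^√2` is a value of `𝔾` and not of `ℂ_p`; so
**no normed field `F` is a tilt base for both** (`isEmpty_tiltMonoidDatum_gaussIrr`), in particular `𝔾` carries NO tilt-monoid
datum over `(ℂ_p^♭, |·|_♭)` and `ℂ_p` none over `𝔾^♭`; **there is no isometric map `𝔾^♭ → ℂ_p^♭` at all** and no isometric
surjection `ℂ_p^♭ → 𝔾^♭` (`range_norm_tilt_eq`); the two-point signature of p448902 admits NO common tilt base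
(`isEmpty_twoPoint_common_tilt_base`); on ANY signature with a common tilt base all residue untilts have ONE value set, and every
untilt sharing a tilt base with `ℂ_p` has values in `p^ℚ` — so the value-set separation of p448902 (`not_topIso_padicComplex_of_norm`)
can never fire there: the LOCATION of what the lineage did (typed sentences) and did not (the same-tilt theorem of [KT18]) discharge.
SEQUEL (`Joshi/UntiltGaussTiltCalibration.lean`, same seat): the CALIBRATION of the typed Def. 4.1.1 (1) these facts allow —
AS TYPED (p431050: abstract `tiltIso` + isometric-INTO `sharp`), `𝔾` nevertheless carries an `ArithHolStructure X A (tilt ℂ_p)`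
(`tiltIso` by `nonempty_ringEquiv_tilt`, `sharp := (ℂ_p ↪ 𝔾) ∘ ♯`), at which Prop. 4.1.7 (1) «same value groups» FAILS and by which
`NeedNotBeTopIso` / `ExistsNonIso X A (tilt ℂ_p)` are inhabited for a non-[KT18] reason; E-t10's ONTO `TiltMonoidDatum` is the
repair, and §1 here is exactly the statement that it excludes `𝔾`. Located, not adjudicated. bears_on: LADDER-ABC:A2.E.
-/

noncomputable section

open Cardinal Filter Topology
open scoped NNReal

namespace Summit.ABC.IUTFork.Joshi

open ATS1 ATS1.TiltModel ATS1.ArithHolStructure Literature.AnabelianGeometry.SemiGraphs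

variable (p : ℕ) [Fact p.Prime]

/-! ## §0 Cardinal bookkeeping: completions, `ℂ_p`, `𝔾`, tilts; Steinitz for tilts -/

namespace TiltCalibration

omit [Fact p.Prime] in
/-- A metric completion is no bigger than the sequences in the space: every point is the limit of a sequence from the dense
image (Fréchet–Urysohn), and limits are unique. [folklore] -/
theorem mk_completion_le (α : Type) [PseudoMetricSpace α] : #(UniformSpace.Completion α) ≤ #α ^ ℵ₀ := by
  have h : ∀ x : UniformSpace.Completion α, ∃ u : ℕ → α,
      Tendsto (fun n => (u n : UniformSpace.Completion α)) atTop (𝓝 x) := by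
    intro x
    obtain ⟨v, hv, hvx⟩ := mem_closure_iff_seq_limit.1 (UniformSpace.Completion.denseRange_coe (α := α) x)
    choose u hu using hv
    refine ⟨u, ?_⟩
    have : (fun n => (u n : UniformSpace.Completion α)) = v := funext hu
    rw [this]
    exact hvx
  choose u hu using h
  have hinj : Function.Injective u := fun x y hxy => by
    have hx := hu x
    rw [hxy] at hx
    exact tendsto_nhds_unique hx (hu y)
  calc #(UniformSpace.Completion α) ≤ #(ℕ → α) := mk_le_of_injective hinj
    _ = #α ^ ℵ₀ := by rw [← power_def, mk_nat]

/-- **`#ℂ_p = 𝔠`** (`≤`: completion of `Q̄_p`, `#Q̄_p = 𝔠` by `Cardinal.mk_padicAlgCl`, `𝔠^ℵ₀ = 𝔠`; `≥`: a complete nontrivially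
normed field, Mathlib `continuum_le_cardinal_of_nontriviallyNormedField`). [folklore] -/
theorem mk_padicComplex : #ℂ_[p] = 𝔠 := by
  apply le_antisymm
  · calc #ℂ_[p] ≤ #(PadicAlgCl p) ^ ℵ₀ := mk_completion_le (PadicAlgCl p)
      _ = 𝔠 := by rw [Cardinal.mk_padicAlgCl, continuum_power_aleph0]
  · exact continuum_le_cardinal_of_nontriviallyNormedField ℂ_[p]

variable {p}

/-- `#K♭ ≤ #K^ℵ₀`: `K♭ = Frac((𝒪_K/p)^perf)` and `(𝒪_K/p)^perf ⊆ (ℕ → 𝒪_K/p)`. [folklore] -/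
theorem mk_tilt_le (U : Untilt p) : #(tilt U) ≤ #U.K ^ ℵ₀ := by
  haveI : Fact (¬ IsUnit ((p : ℕ) : int U)) := ⟨not_isUnit_p U⟩
  have h1 : #(ModP (int U) p) ≤ #U.K :=
    (mk_le_of_surjective Ideal.Quotient.mk_surjective).trans (mk_le_of_injective Subtype.val_injective)
  calc #(tilt U) = #(FractionRing (PreTilt (int U) p)) := rfl
    _ = #(PreTilt (int U) p) := Cardinal.mk_fractionRing _
    _ ≤ #(ℕ → ModP (int U) p) := by
        unfold PreTilt Perfection
        exact mk_subtype_le _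
    _ = #(ModP (int U) p) ^ ℵ₀ := by rw [← power_def, mk_nat]
    _ ≤ #U.K ^ ℵ₀ := power_le_power_right h1

/-- Every norm value of `K` is a norm value of `(K♭, |·|_♭)` (E-t10's `range_norm_tilt_eq`). [folklore] -/
theorem exists_norm_tilt_eq (U : Untilt p) (a : U.K) : ∃ y : tilt U, (letI := normedFieldTilt U; ‖y‖) = ‖a‖ := by
  have : ‖a‖ ∈ Set.range (fun y : tilt U => letI := normedFieldTilt U; ‖y‖) := by
    rw [range_norm_tilt_eq U]; exact ⟨a, rfl⟩
  exact this

/-- Every norm value of `(K♭, |·|_♭)` is a norm value of `K`. [folklore] -/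
theorem exists_norm_eq_norm_tilt (U : Untilt p) (z : tilt U) : ∃ a : U.K, ‖a‖ = (letI := normedFieldTilt U; ‖z‖) := by
  have : (letI := normedFieldTilt U; ‖z‖) ∈ Set.range (fun a : U.K => ‖a‖) := by
    rw [← range_norm_tilt_eq U]; exact ⟨z, rfl⟩
  exact this

/-- **`𝔠 ≤ #K♭`** for EVERY untilt: `(K♭, |·|_♭)` is a complete (p447287) nontrivially normed field (it has an element of norm
`‖p‖_K ∈ (0,1)`). [folklore] -/
theorem continuum_le_mk_tilt (U : Untilt p) : 𝔠 ≤ #(tilt U) := by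
  obtain ⟨y, hy⟩ := exists_norm_tilt_eq U (p : U.K)
  have hp0 : 0 < ‖(p : U.K)‖ := norm_pos_iff.2 (natCast_p_ne_zero U)
  have hy0 : (letI := normedFieldTilt U; y ≠ 0) := by
    letI := normedFieldTilt U
    intro h
    have h0 : ‖y‖ = 0 := by rw [h]; exact norm_zero
    rw [h0] at hy
    exact hp0.ne hy
  have hy1 : (letI := normedFieldTilt U; ‖y‖) ≠ 1 := by rw [hy]; exact U.norm_p_lt_one.ne
  exact @continuum_le_cardinal_of_nontriviallyNormedField (tilt U)
    (@NontriviallyNormedField.ofNormNeOne (tilt U) (normedFieldTilt U) ⟨y, hy0, hy1⟩) (completeSpace_tilt U)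

/-- **`#K♭ = 𝔠`** for every untilt of cardinality `≤ 𝔠`. [folklore] -/
theorem mk_tilt (U : Untilt p) (hU : #U.K ≤ 𝔠) : #(tilt U) = 𝔠 :=
  le_antisymm ((mk_tilt_le U).trans (by
    calc #U.K ^ ℵ₀ ≤ 𝔠 ^ ℵ₀ := power_le_power_right hU
      _ = 𝔠 := continuum_power_aleph0)) (continuum_le_mk_tilt U)

/-- **Any two untilts of cardinality `≤ 𝔠` have ABSTRACTLY ISOMORPHIC tilts** (Steinitz: both tilts are algebraically closed —
E-t10's `isAlgClosed_tilt` — of characteristic `p` — `charP_tilt` — and of cardinality `𝔠`). So the slot `tiltIso : K♭ ≃+* F` of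
the typed Def. 4.1.1 (1) is inhabited for EVERY such untilt over EVERY such tilt base. [folklore] -/
theorem nonempty_ringEquiv_tilt (U V : Untilt p) (hU : #U.K ≤ 𝔠) (hV : #V.K ≤ 𝔠) : Nonempty (tilt U ≃+* tilt V) := by
  haveI := isAlgClosed_tilt U
  haveI := isAlgClosed_tilt V
  haveI := charP_tilt U
  haveI := charP_tilt V
  refine IsAlgClosed.ringEquiv_of_equiv_of_char_eq p ?_ (Cardinal.eq.1 (by rw [mk_tilt U hU, mk_tilt V hV]))
  rw [mk_tilt U hU]
  exact aleph0_lt_continuum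

/-- Two untilts identified (multiplicatively, onto, isometrically in degree `0`) with ONE tilt base `F` have THE SAME VALUE SET
(E-t10's `TiltMonoidDatum.range_norm_eq`, twice) — the kernel form of Prop. 4.1.7 (1) «the same value groups as that of F» for a
pair. [folklore] -/
theorem range_norm_eq_of_tiltMonoidDatum {U V : Untilt p} {F : Type} [NormedField F]
    (T : TiltMonoidDatum U F) (T' : TiltMonoidDatum V F) :
    Set.range (fun a : U.K => ‖a‖) = Set.range (fun a : V.K => ‖a‖) := by
  rw [T.range_norm_eq, T'.range_norm_eq]

end TiltCalibration

namespace GaussUntilt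

open TiltCalibration

section Cardinal

variable (r : ℝ) (hr : 0 < r)

/-- `#ℚ_p(X) ≤ 𝔠` (`= #ℚ_p[X]`, Mathlib `IsFractionRing.cardinalMk`, `Polynomial.cardinalMk_le_max`, `Cardinal.mk_padic`). [folklore] -/
theorem mk_GFun_le : #(GFun p r hr) ≤ 𝔠 := by
  rw [Cardinal.mk_congr (WithAbs.equiv (gaussAbs p r hr)).toEquiv,
    IsFractionRing.cardinalMk (Polynomial ℚ_[p]) (RatFunc ℚ_[p])]
  exact Polynomial.cardinalMk_le_max.trans (by rw [Cardinal.mk_padic, max_eq_left aleph0_le_continuum])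

/-- `#\widehat{ℚ_p(X)} ≤ 𝔠`. [folklore] -/
theorem mk_GFunHat_le : #(GFunHat p r hr) ≤ 𝔠 :=
  (mk_completion_le (GFun p r hr)).trans (by
    calc #(GFun p r hr) ^ ℵ₀ ≤ 𝔠 ^ ℵ₀ := power_le_power_right (mk_GFun_le p r hr)
      _ = 𝔠 := continuum_power_aleph0)

/-- `#GAlgCl ≤ 𝔠` (algebraic over `GFunHat`, Mathlib `Algebra.IsAlgebraic.cardinalMk_le_max`). [folklore] -/
theorem mk_GAlgCl_le : #(GAlgCl p r hr) ≤ 𝔠 :=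
  (Algebra.IsAlgebraic.cardinalMk_le_max (GFunHat p r hr) (GAlgCl p r hr)).trans
    (max_le (mk_GFunHat_le p r hr) aleph0_le_continuum)

/-- **`#𝔾 = 𝔠`**: the Gauss untilt has the cardinality of the continuum. [folklore] -/
theorem mk_GField : #(GField p r hr) = 𝔠 :=
  le_antisymm ((mk_completion_le (GAlgCl p r hr)).trans (by
    calc #(GAlgCl p r hr) ^ ℵ₀ ≤ 𝔠 ^ ℵ₀ := power_le_power_right (mk_GAlgCl_le p r hr)
      _ = 𝔠 := continuum_power_aleph0))
    (continuum_le_cardinal_of_nontriviallyNormedField (GField p r hr))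

end Cardinal

/-- `#𝔾 = 𝔠` for `𝔾 = Untilt.gaussIrr p`. [folklore] -/
theorem mk_gaussIrr : #(Untilt.gaussIrr p).K = 𝔠 := mk_GField p _ _

/-- `#ℂ_p = 𝔠` on E-t1's carrier `Untilt.padicComplex p`. [folklore] -/
theorem mk_padicComplex_untilt : #(Untilt.padicComplex p).K = 𝔠 := mk_padicComplex p

/-! ## §1 `𝔾` is NOT an untilt of `ℂ_p^♭`: no common tilt base, no isometry of tilts -/

/-- `p^√2` is a norm value of `𝔾` (`‖gaussT‖ = p^√2`, p447273). [folklore] -/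
theorem rpow_sqrt_two_mem_range_norm_gaussIrr :
    (p : ℝ) ^ Real.sqrt 2 ∈ Set.range (fun a : (Untilt.gaussIrr p).K => ‖a‖) :=
  ⟨gaussT p _ _, norm_gaussT p _ _⟩

/-- `p^√2` is NOT a norm value of `ℂ_p` (the value set of `ℂ_p` is `p^ℚ ∪ {0}`, p448902 `exists_norm_pow_eq_padicComplex`;
`√2 ∉ ℚ`). [folklore] -/
theorem rpow_sqrt_two_not_mem_range_norm_padicComplex :
    (p : ℝ) ^ Real.sqrt 2 ∉ Set.range (fun a : (Untilt.padicComplex p).K => ‖a‖) := by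
  rintro ⟨a, ha⟩
  change ‖a‖ = _ at ha
  have ha0 : a ≠ 0 := by
    intro h
    have h0 : ‖a‖ = 0 := by rw [h]; exact norm_zero
    rw [h0] at ha
    exact (rpow_sqrt_two_pos p).ne ha
  obtain ⟨n, hn, m, hm⟩ := exists_norm_pow_eq_padicComplex p a ha0
  exact rpow_sqrt_two_pow_ne p n hn m (by rw [← ha]; exact hm)

/-- **The value sets of `𝔾` and `ℂ_p` differ.** [folklore] -/
theorem range_norm_gaussIrr_ne_padicComplex :
    Set.range (fun a : (Untilt.gaussIrr p).K => ‖a‖) ≠ Set.range (fun a : (Untilt.padicComplex p).K => ‖a‖) :=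
  fun h => rpow_sqrt_two_not_mem_range_norm_padicComplex p (h ▸ rpow_sqrt_two_mem_range_norm_gaussIrr p)

/-- **No normed field is a tilt base for both `ℂ_p` and `𝔾`**: given a tilt-monoid datum of `ℂ_p` over `F`, `𝔾` admits none over
`F` (they would share a value set). The kernel form of the caveat of p447273/p448902 («`𝔾` is not an untilt of `ℂ_p^♭`»).
[folklore] -/
theorem isEmpty_tiltMonoidDatum_gaussIrr {F : Type} [NormedField F] (T : TiltMonoidDatum (Untilt.padicComplex p) F) :
    IsEmpty (TiltMonoidDatum (Untilt.gaussIrr p) F) :=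
  ⟨fun T' => range_norm_gaussIrr_ne_padicComplex p (range_norm_eq_of_tiltMonoidDatum T' T)⟩

/-- **`𝔾` carries NO tilt-monoid datum over `ℂ_p^♭ = (ATS1.tilt ℂ_p, |·|_♭)`** (E-t10's `tiltMonoidDatum ℂ_p` is one for `ℂ_p`):
`𝔾` is not an untilt of `ℂ_p^♭` in the ONTO sense of p433682/p442777. [folklore] -/
theorem isEmpty_tiltMonoidDatum_gaussIrr_padicTilt :
    IsEmpty (@TiltMonoidDatum p _ (Untilt.gaussIrr p) (tilt (Untilt.padicComplex p))
      (normedFieldTilt (Untilt.padicComplex p))) :=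
  @isEmpty_tiltMonoidDatum_gaussIrr p _ (tilt (Untilt.padicComplex p)) (normedFieldTilt (Untilt.padicComplex p))
    (tiltMonoidDatum (Untilt.padicComplex p))

/-- … and symmetrically `ℂ_p` carries NO tilt-monoid datum over `𝔾^♭`. [folklore] -/
theorem isEmpty_tiltMonoidDatum_padicComplex_gaussTilt :
    IsEmpty (@TiltMonoidDatum p _ (Untilt.padicComplex p) (tilt (Untilt.gaussIrr p))
      (normedFieldTilt (Untilt.gaussIrr p))) :=
  ⟨fun T => range_norm_gaussIrr_ne_padicComplex p
    (@range_norm_eq_of_tiltMonoidDatum p _ _ _ (tilt (Untilt.gaussIrr p)) (normedFieldTilt (Untilt.gaussIrr p))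
      (tiltMonoidDatum (Untilt.gaussIrr p)) T)⟩

/-- **There is NO ISOMETRIC MAP `𝔾^♭ → ℂ_p^♭`** — not even a non-surjective, non-additive one: `𝔾^♭` has an element of norm
`p^√2` (`range_norm_tilt_eq`), whose image would give `ℂ_p` the value `p^√2`. In particular `ℂ_p^♭` and `𝔾^♭` are NOT
isometric: `𝔾` is an untilt (typed sense) of a perfectoid field NOT isometric to `ℂ_p^♭` (cf. [J-I] §3.5 «K♭ isometric with F»,
Rmk. 3.16.3 «with tilts isometric to ℂ_p^♭»). [folklore] -/
theorem not_isometric_gaussTilt_to_padicTilt (f : tilt (Untilt.gaussIrr p) → tilt (Untilt.padicComplex p)) :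
    ¬ ∀ y, (letI := normedFieldTilt (Untilt.padicComplex p); ‖f y‖) =
      (letI := normedFieldTilt (Untilt.gaussIrr p); ‖y‖) := by
  intro hf
  obtain ⟨t, ht⟩ := rpow_sqrt_two_mem_range_norm_gaussIrr p
  obtain ⟨y, hy⟩ := exists_norm_tilt_eq (Untilt.gaussIrr p) t
  obtain ⟨a, ha⟩ := exists_norm_eq_norm_tilt (Untilt.padicComplex p) (f y)
  exact rpow_sqrt_two_not_mem_range_norm_padicComplex p ⟨a, by change ‖a‖ = _; rw [ha, hf y, hy]; exact ht⟩

/-- Hence no isometric field isomorphism `𝔾^♭ ≃+* ℂ_p^♭`. [folklore] -/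
theorem not_exists_isometric_ringEquiv_tilt :
    ¬ ∃ e : tilt (Untilt.gaussIrr p) ≃+* tilt (Untilt.padicComplex p),
      ∀ y, (letI := normedFieldTilt (Untilt.padicComplex p); ‖e y‖) =
        (letI := normedFieldTilt (Untilt.gaussIrr p); ‖y‖) :=
  fun ⟨e, he⟩ => not_isometric_gaussTilt_to_padicTilt p e he

/-- … and no isometric SURJECTION `ℂ_p^♭ → 𝔾^♭` (an isometric non-surjective map in this direction is not excluded by value
sets: `p^ℚ ⊂ p^ℚ·(p^√2)^ℚ`). [folklore] -/
theorem not_isometric_surjective_padicTilt_to_gaussTilt (f : tilt (Untilt.padicComplex p) → tilt (Untilt.gaussIrr p))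
    (hf : Function.Surjective f) :
    ¬ ∀ y, (letI := normedFieldTilt (Untilt.gaussIrr p); ‖f y‖) =
      (letI := normedFieldTilt (Untilt.padicComplex p); ‖y‖) := by
  intro hiso
  obtain ⟨t, ht⟩ := rpow_sqrt_two_mem_range_norm_gaussIrr p
  obtain ⟨z, hz⟩ := exists_norm_tilt_eq (Untilt.gaussIrr p) t
  obtain ⟨y, rfl⟩ := hf z
  obtain ⟨a, ha⟩ := exists_norm_eq_norm_tilt (Untilt.padicComplex p) y
  exact rpow_sqrt_two_not_mem_range_norm_padicComplex p ⟨a, by change ‖a‖ = _; rw [ha, ← hiso y, hz]; exact ht⟩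

/-- **The two-point signature of p448902 admits NO common tilt base**: no normed field `F` carries tilt-monoid data for all its
residue untilts (`ℂ_p` at `e₁`, `𝔾` at `e₂`). Its `ExistsNonIsomorphic` / `ActionChangesTopology` (p448902) are therefore NOT
instances of the same-tilt mechanism of [J-I] §3.7 / Rmk. 3.16.3 / Prop. 4.1.7 (2) «if F = ℂ_p^♭» — the typed signature
`UntiltPoints` records no tilt; located, as the g3 docstrings say in prose. [folklore] -/
theorem isEmpty_twoPoint_common_tilt_base (F : Type) [NormedField F] :
    IsEmpty (∀ y : (twoPoint p).Pt, TiltMonoidDatum ((twoPoint p).untilt y) F) := by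
  refine ⟨fun T => ?_⟩
  have T₁ : TiltMonoidDatum (Untilt.padicComplex p) F := twoPoint_untilt_e1 p ▸ T e1
  have T₂ : TiltMonoidDatum (Untilt.gaussIrr p) F := twoPoint_untilt_e2 p ▸ T e2
  exact (isEmpty_tiltMonoidDatum_gaussIrr p T₁).false T₂

/-- **On a signature WITH a common tilt base all residue untilts have ONE value set** (any `UntiltPoints` datum of E-t1, any
`F`): the value-set separation by which p448902 proved `ExistsNonIsomorphic` on `twoPoint` is unavailable there. [folklore] -/
theorem _root_.Summit.ABC.IUTFork.Joshi.UntiltPoints.range_norm_eq_of_common_tilt_base {𝒪E : Type} [CommRing 𝒪E]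
    (D : UntiltPoints p 𝒪E) {F : Type} [NormedField F] (T : ∀ y, TiltMonoidDatum (D.untilt y) F) (y y' : D.Pt) :
    Set.range (fun a : (D.untilt y).K => ‖a‖) = Set.range (fun a : (D.untilt y').K => ‖a‖) :=
  range_norm_eq_of_tiltMonoidDatum (T y) (T y')

/-- **An untilt sharing a tilt base with `ℂ_p` has value set inside `p^ℚ`**: every `t ≠ 0` has `‖t‖ⁿ = p^m` for some `n ≥ 1`,
`m ∈ ℤ`. So the separation hypothesis of p448902's `not_topIso_padicComplex_of_norm` (`rⁿ ≠ p^m`) is UNSATISFIABLE on genuine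
untilts of `ℂ_p^♭`: non-homeomorphy of same-tilt untilts ([KedlayaTemkin2018, Thm 1.3], cited by [J-I] §3.7) is invisible to
value sets — the LOCATION of what this lineage's mechanism can and cannot witness. [folklore] -/
theorem exists_norm_pow_eq_of_common_tilt_base {F : Type} [NormedField F]
    (T : TiltMonoidDatum (Untilt.padicComplex p) F) {V : Untilt p} (T' : TiltMonoidDatum V F) (t : V.K) (ht : t ≠ 0) :
    ∃ n : ℕ, 0 < n ∧ ∃ m : ℤ, ‖t‖ ^ n = (p : ℝ) ^ m := by
  obtain ⟨a, ha⟩ : ‖t‖ ∈ Set.range (fun a : (Untilt.padicComplex p).K => ‖a‖) := by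
    rw [range_norm_eq_of_tiltMonoidDatum T T']; exact ⟨t, rfl⟩
  change ‖a‖ = ‖t‖ at ha
  have ha0 : a ≠ 0 := by
    intro h
    have h0 : ‖a‖ = 0 := by rw [h]; exact norm_zero
    rw [h0] at ha
    exact norm_ne_zero_iff.2 ht ha.symm
  obtain ⟨n, hn, m, hm⟩ := exists_norm_pow_eq_padicComplex p a ha0
  exact ⟨n, hn, m, by rw [← ha]; exact hm⟩

/-- For citation: ANY untilt holding an element of norm `p^√2` (such as `𝔾`) shares NO tilt base with `ℂ_p`. [folklore] -/
theorem isEmpty_tiltMonoidDatum_of_norm_eq {F : Type} [NormedField F] (T : TiltMonoidDatum (Untilt.padicComplex p) F)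
    (V : Untilt p) (t : V.K) (ht : ‖t‖ = (p : ℝ) ^ Real.sqrt 2) : IsEmpty (TiltMonoidDatum V F) := by
  refine ⟨fun T' => ?_⟩
  have ht0 : t ≠ 0 := by
    intro h
    have h0 : ‖t‖ = 0 := by rw [h]; exact norm_zero
    rw [h0] at ht
    exact (rpow_sqrt_two_pos p).ne ht
  obtain ⟨n, hn, m, hm⟩ := exists_norm_pow_eq_of_common_tilt_base p T T' t ht0
  exact rpow_sqrt_two_pow_ne p n hn m (by rw [← ht]; exact hm)

end GaussUntilt

end Summit.ABC.IUTFork.Joshi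

end
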